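import Literature.MathematicalPhysics.PowerSystems.StructurePreservingNonMinimumInstability
import Literature.MathematicalPhysics.PowerSystems.StructurePreservingSyncExponentialStability
import Literature.MathematicalPhysics.PowerSystems.NormalOperationStability
import HarnessLib

/-!
# Structure-preserving (Bergen–Hill) model: «normal operation ⇒ stable» (Manik–Timme–Witthaut 2017,
# Cor. 1) in the frame of the data, and on a radial network «ONE IS STABLE and 2ᴺ⁻¹ − 1 are
# unstable» (Cor. 2) LITERALLY — both clauses, for the forward motions of the structure-preserving model

Topic `Literature/MathematicalPhysics/PowerSystems`, namespaces
`Literature.MathematicalPhysics.PowerSystems.ClassicalModel` (§1, the certificate) and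
`Literature.MathematicalPhysics.PowerSystems.BergenHill` (§2–§4). Companion of
`StructurePreservingNonMinimumInstability.lean` (gridfusion-lit-1: the UNSTABLE clause of Cor. 2 for
the structure-preserving motions by the energy route, `BergenHill.ncard_unstable_syncStates_of_tree`,
and the static half of «one is stable», `BergenHill.isLocalMin_syncPotential_of_cohesive_of_tree`) and
of `StructurePreservingSyncExponentialStability.lean` (gridfusion-lit-2: MTW2017 Lemma 1's STABLE clause
in certificate form for an equilibrium IN THE FRAME WHERE `Σ P⁰ᵢ = 0`,
`BergenHill.syncEquilibrium_locally_expStable_of_posCurvature`, for solutions given at every real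
time). This file closes the gap between the two: the stable clause is transported to the FRAME OF THE
DATA (synchronous frequency `ω₀ = ΣP⁰ᵢ/ΣDᵢ ≠ 0` allowed, synchronous states `fₖ(θe) = P̄ₖ`) and to
FORWARD solutions (`∀ t ≥ 0, S.IsSolutionAt δ v t`, the solution class of the unstable clause), the
PSD + kernel certificate is discharged from «normal operation» on a connected coupling graph with no
arc hypothesis, and on a radial network the two clauses are assembled into the printed sentence.
Everything below is PROVED (no definition, no named fact, no new axiom); the tree's records and
theorems are used unchanged.

SOURCES (read on the page this session).

* D. Manik, M. Timme, D. Witthaut, *Cycle flows and multistability in oscillatory networks*, Chaos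
  27 (2017) 083123 [ManikTimmeWitthaut2017] (`lit read arxiv:1611.09825`, chunks p0004, p0010, p0011).
  **Lemma 1** (p0004 L46–L55): «If … μ_k > 0 for all k ∈ {2,…,N}, then this fixed point is
  transversally asymptotically stable for both Kuramoto system and the power grid model system.»
  **Corollary 1** (p0004 L68–L77): «Consider a simply connected network. A fixed point θ* is
  transversally asymptotically stable if cos(θ*ᵢ − θ*ⱼ) > 0 holds for all edges (i, j) in the
  network. Then the network is said to be in "normal operation".» **Corollary 2** (p0010 L120–L124):
  «In a tree network, there is either no fixed point or there are 2^{N−1} fixed points of which one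
  is stable and 2^{N−1} − 1 are unstable», proof p0011 L12–L35 (the stable one «solely on the basis
  (corr:stab-phasediff)» = Cor. 1; the others by the negative test vector `vᵀMv = K^red_{ℓ,ℓ+1} < 0`).
* F. Dörfler, M. Chertkov, F. Bullo, PNAS 110 (2013), SI [DorflerChertkovBullo2013] (`lit read
  arxiv:1208.0045`, chunks p0013–p0016, p0019): §2.1/§2.4 the mixed first/second-order «coupled
  oscillator model» IS the structure-preserving power network model (p0014 L38); §3.1 **SI Lemma 1**
  (p0016 L11–L27, synchronization equivalence, «locally exponentially stable synchronization
  manifold») with **Lemma 2** (p0016 L31 ff., connected graph, Jacobian `−B diag(aᵢⱼcos(θᵢ − θⱼ))Bᵀ`)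
  — the tree's spectral route `StructurePreservingSyncExponentialStability` follows it; §3.2
  **Thm 2 (G1)** (p0019 L11–L17: «Assume that G(V, E, A) is acyclic. There exists an exponentially
  stable equilibrium θ* ∈ Δ̄_G(γ) if and only if …»).
* K. R. Padiyar, *Structure Preserving Energy Functions in Power Systems* (CRC 2013) [Padiyar2013]
  §3.2 eqs. (3.2)–(3.5) through the model record `StructurePreservingModel.lean` (`BergenHill n`,
  `IsSolutionAt`, `syncFrequency` = `ω₀`, `shiftedInjection` = `P̄`, `shifted`,
  `isSolutionAt_shifted_iff`) and §3.2 (3.10a)–(3.10b) through `StructurePreservingDichotomy.lean`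
  §8 (`exists_solution`, `solution_unique`: every initial state has a unique motion).

## What is proved

* §1 (namespace `ClassicalModel`, any symmetric coupling matrix `C`, any angle vector `θ`)
  **`posCurvature_of_cohesive_of_connected`** — on a connected coupling graph
  (`CouplingConnected C`), `Cᵢⱼcos(θᵢ − θⱼ) > 0` on every line `Cᵢⱼ ≠ 0` ⇒ the real Hesse form
  `u ↦ Σᵢ uᵢ Σⱼ Cᵢⱼcos(θᵢ − θⱼ)(uᵢ − uⱼ)` is `≥ 0` with kernel exactly the constant vectors (the
  printed step «M is a Laplacian … positive semi-definite … eigenvalue 0 only for (1,…,1)»; no arc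
  hypothesis `|θᵢ − θⱼ| < π/2`, so states of the period box whose line angles wrap are covered);
  **`posCurvature_of_cohesive_of_rootedTree`** — the same on a rooted tree of positive lines with
  `cos(θᵢ − θ_{parent i}) > 0` on every branch (connectivity from
  `ClassicalModel.couplingConnected_of_rootedTree`).
* §2 (namespace `BergenHill`, `Mᵢ ≥ 0`, `Dᵢ > 0`, `b` symmetric)
  `shifted_linWeight`; **`locally_expStable_of_posCurvature_of_forward`** — lit-2's
  `syncEquilibrium_locally_expStable_of_posCurvature` for FORWARD solutions (`∀ t ≥ 0`), via the
  global motion of `exists_solution` and `solution_unique`; **`syncSolution_locally_expStable_of_posCurvature`**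
  — THE STABLE CLAUSE IN THE FRAME OF THE DATA: a synchronous state `θe` (`fₖ(θe) = P̄ₖ`) with the
  PSD + kernel certificate gives `ρ, k, λ > 0` such that every forward solution `(δ, v)` with
  `‖(δ(0) − θe, v_G(0) − ω₀𝟙)‖ < ρ` satisfies
  `‖(δ(t) − ω₀t𝟙 − (θe + c𝟙), v_G(t) − ω₀𝟙)‖ ≤ k‖(δ(0) − (θe + c𝟙), v_G(0) − ω₀𝟙)‖e^{−λt}` for
  `t ≥ 0`, `c = (Σᵢ Dᵢ(δᵢ(0) − θeᵢ) + Σ_{gen} Mᵢ(vᵢ(0) − ω₀))/Σᵢ Dᵢ` the rotation offset of the leaf of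
  the initial state (change of frame `isSolutionAt_shifted_iff`);
  **`syncSolution_locally_expStable_of_normalOperation`** — COROLLARY 1 for the structure-preserving
  tier: `bᵢⱼ ≥ 0`, connected coupling graph, `cos(θeᵢ − θeⱼ) > 0` on every line ⇒ the synchronous
  solution `(θe + ω₀t𝟙, ω₀𝟙)` is locally exponentially stable modulo the uniform rotation.
* §3 RADIAL NETWORKS, hypothesis-free: **`syncSolution_locally_expStable_of_cohesive_of_tree`** — `b`
  supported on the lines of a rooted tree with positive line coefficients: the phase-cohesive
  synchronous state (`cos(θcᵢ − θc_{parent i}) > 0` on every branch) is a locally exponentially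
  stable synchronous solution (modulo rotation).
* §4 **`one_stable_and_ncard_unstable_syncStates_of_tree`** — COROLLARY 2, BOTH CLAUSES, LITERALLY,
  for the forward motions of the structure-preserving model on a radial network with strictly feasible
  tree flows: (i) the pinned synchronous states of the period box other than the cohesive `θc` number
  exactly `2ⁿ⁻¹ − 1` and every one is an UNSTABLE synchronous solution
  (`ncard_unstable_syncStates_of_tree`, energy route); (ii) `θc` is a locally exponentially STABLE
  synchronous solution (§3, spectral route).

DEVIATIONS FROM THE PRINTED PROOF. Cor. 1's Laplacian step is done on the quadratic form (§1) and
Lemma 1's stable clause is the tree's linearisation theorem (Lyapunov's indirect method in the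
rotation-quotient form, lit-2), so the conclusion is local EXPONENTIAL stability modulo rotation —
the «transversally asymptotically stable» of the source, with a rate; the unstable clause of Cor. 2 is
the tree's energy-route theorem (lit-1), nonlinear Lyapunov instability of the synchronous solution,
valid without nondegeneracy. The two clauses therefore come by different routes but speak about the
same objects: forward solutions `(δ, v)` of Padiyar's (3.2) and the synchronous solutions
`(θ + ω₀t𝟙, ω₀𝟙)` of the pinned synchronous states `θ` of one period box.

THREE COLUMNS (LADDER-GRIDFUSION honest framing). CERTIFIED for MODEL `M` = structure-preserving
classical model (3.2): lossless lines, `|Vᵢ| = 1`, frequency-dependent loads `Dᵢ > 0`, classical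
machines `Mᵢ > 0` with damping, `Mᵢ = 0` at load buses, no reactive-power / voltage dynamics
(MODEL-VALIDITY MV-3); CLASS `C` = forward solutions from initial data with `(δ(0) − θe, v_G(0) − ω₀𝟙)`
in the `ρ`-ball (stable clause; `ρ, k, λ` existential) / bus angles on the leaf arbitrarily close to
the state with the rotors at `ω₀` (unstable clause). «Stable» / «unstable» refer to synchronous
solutions of MODEL `M`, never to a grid. NOT CLAIMED: the size of `ρ` or the rate `λ`; anything for
meshed networks beyond §2 (the certificate must then be supplied, e.g. by §1 on a connected graph in
normal operation or by an exact LDLᵀ computation); anything about voltages, lossy lines, or a grid.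
-/

noncomputable section

open Real Set Filter Topology Metric Finset

namespace Literature.MathematicalPhysics.PowerSystems

/-! ### §1. «M is a Laplacian»: normal operation on a connected coupling graph gives the PSD + kernel
certificate of the Hesse form (no arc hypothesis) -/

namespace ClassicalModel

variable {n : ℕ}

/-- **Normal operation on a connected coupling graph ⇒ the Hesse form is positive semidefinite with
kernel the constants** (`C` symmetric, `CouplingConnected C`): if `Cᵢⱼcos(θᵢ − θⱼ) > 0` on every line
(`i ≠ j`, `Cᵢⱼ ≠ 0`), then `Σᵢ uᵢ Σⱼ Cᵢⱼcos(θᵢ − θⱼ)(uᵢ − uⱼ) = ½ΣᵢΣⱼ Cᵢⱼcos(θᵢ − θⱼ)(uᵢ − uⱼ)² ≥ 0`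
for every real `u`, with equality only for constant `u` («M is a Laplacian matrix … for which the
following properties hold: … positive semi-definite … one eigenvector (1,1,⋯,1) with eigenvalue 0»
— on a connected graph with positive residual capacities the eigenvalue `0` is simple). No arc
hypothesis `|θᵢ − θⱼ| < π/2` is needed: only the sign of the residual capacities enters.
[cite: ManikTimmeWitthaut2017, §3 Lemma 1 proof and Cor. 1 («normal operation»); DorflerChertkovBullo2013, SI §3.1 Lemma 2 (nullspace 𝟙ₙ on a connected graph)] -/
theorem posCurvature_of_cohesive_of_connected {C : Fin n → Fin n → ℝ} (hC : ∀ i j, C i j = C j i)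
    (hconn : CouplingConnected C) {θ : Fin n → ℝ}
    (hcoh : ∀ i j, i ≠ j → C i j ≠ 0 → 0 < C i j * Real.cos (θ i - θ j)) :
    (∀ u : Fin n → ℝ, 0 ≤ ∑ i, u i * ∑ j, C i j * Real.cos (θ i - θ j) * (u i - u j)) ∧
    (∀ u : Fin n → ℝ, ∑ i, u i * ∑ j, C i j * Real.cos (θ i - θ j) * (u i - u j) = 0 →
      ∃ a : ℝ, u = fun _ => a) := by
  have hws : ∀ i j, C i j * Real.cos (θ i - θ j) = C j i * Real.cos (θ j - θ i) := fun i j => by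
    rw [hC i j, ← Real.cos_neg, neg_sub]
  have hterm : ∀ (u : Fin n → ℝ) (i j : Fin n),
      0 ≤ C i j * Real.cos (θ i - θ j) * (u i - u j) ^ 2 := by
    intro u i j
    by_cases hij : i = j
    · subst hij
      simp
    · by_cases h0 : C i j = 0
      · rw [h0]
        simp
      · exact mul_nonneg (hcoh i j hij h0).le (sq_nonneg _)
  have hform : ∀ u : Fin n → ℝ, ∑ i, u i * ∑ j, C i j * Real.cos (θ i - θ j) * (u i - u j)
      = 1 / 2 * ∑ i, ∑ j, C i j * Real.cos (θ i - θ j) * (u i - u j) ^ 2 := fun u =>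
    DroopNetwork.lapForm_eq_half_sum (c := fun i j => C i j * Real.cos (θ i - θ j)) hws u
  refine ⟨fun u => ?_, fun u hu => ?_⟩
  · rw [hform u]
    exact mul_nonneg (by norm_num)
      (Finset.sum_nonneg fun i _ => Finset.sum_nonneg fun j _ => hterm u i j)
  · rw [hform u] at hu
    have hsum : ∑ i, ∑ j, C i j * Real.cos (θ i - θ j) * (u i - u j) ^ 2 = 0 := by linarith
    have hij0 : ∀ i j, C i j * Real.cos (θ i - θ j) * (u i - u j) ^ 2 = 0 := by
      intro i j
      have hrow := (Finset.sum_eq_zero_iff_of_nonneg fun i _ =>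
        Finset.sum_nonneg fun j _ => hterm u i j).1 hsum i (Finset.mem_univ i)
      exact (Finset.sum_eq_zero_iff_of_nonneg fun j _ => hterm u i j).1 hrow j (Finset.mem_univ j)
    have hlines : ∀ i j, i ≠ j → 0 < C i j →
        u i - u j = (0 : Fin n → ℝ) i - (0 : Fin n → ℝ) j := by
      intro i j hij hpos
      have hw : 0 < C i j * Real.cos (θ i - θ j) := hcoh i j hij hpos.ne'
      have h0 : (u i - u j) ^ 2 = 0 := by
        rcases mul_eq_zero.1 (hij0 i j) with h | h
        · exact absurd h hw.ne'
        · exact h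
      simpa using pow_eq_zero_iff (n := 2) (by norm_num) |>.1 h0
    obtain ⟨a, hau⟩ := exists_const_of_lineAngles_eq hconn hlines
    exact ⟨a, funext fun i => by simpa using hau i⟩

/-- **The certificate on a radial network, hypothesis-free**: `C` symmetric and supported on the
lines of a rooted tree (`parent`, `depth` increasing away from `root`) with positive line
coefficients `C_{i, parent i} > 0`, and an angle vector with `cos(θᵢ − θ_{parent i}) > 0` on every
branch ⇒ the Hesse form `u ↦ Σᵢ uᵢ Σⱼ Cᵢⱼcos(θᵢ − θⱼ)(uᵢ − uⱼ)` is `≥ 0` with kernel the constants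
(a tree of positive lines is a connected coupling graph, `couplingConnected_of_rootedTree`; every
line is a branch). This is the hypothesis of Lemma 1's stable clause for the «+»-pattern state of
Cor. 2. [cite: ManikTimmeWitthaut2017, §5.2 Cor. 2 proof («solely on the basis (corr:stab-phasediff)») and §3 Cor. 1; DorflerChertkovBullo2013, SI §3.2 Thm 2 (acyclic graphs)] -/
theorem posCurvature_of_cohesive_of_rootedTree {root : Fin n} {parent : Fin n → Fin n}
    {depth : Fin n → ℕ} (hdepth : ∀ i, i ≠ root → depth i = depth (parent i) + 1)
    {C : Fin n → Fin n → ℝ} (hC : ∀ i j, C i j = C j i)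
    (htree : ∀ i j, i ≠ j → C i j ≠ 0 → (i ≠ root ∧ j = parent i) ∨ (j ≠ root ∧ i = parent j))
    (ha : ∀ i, i ≠ root → 0 < C i (parent i)) {θ : Fin n → ℝ}
    (hcoh : ∀ i, i ≠ root → 0 < Real.cos (θ i - θ (parent i))) :
    (∀ u : Fin n → ℝ, 0 ≤ ∑ i, u i * ∑ j, C i j * Real.cos (θ i - θ j) * (u i - u j)) ∧
    (∀ u : Fin n → ℝ, ∑ i, u i * ∑ j, C i j * Real.cos (θ i - θ j) * (u i - u j) = 0 →
      ∃ a : ℝ, u = fun _ => a) := by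
  refine posCurvature_of_cohesive_of_connected hC (couplingConnected_of_rootedTree hdepth hC ha)
    fun i j hij hne => ?_
  rcases htree i j hij hne with ⟨hi, hj⟩ | ⟨hj, hi⟩
  · subst hj
    exact mul_pos (ha i hi) (hcoh i hi)
  · subst hi
    rw [hC (parent j) j, ← Real.cos_neg, neg_sub]
    exact mul_pos (ha j hj) (hcoh j hj)

end ClassicalModel

/-! ### §2. The stable clause for the structure-preserving model IN THE FRAME OF THE DATA and for
FORWARD solutions; Corollary 1 -/

namespace BergenHill

variable {n : ℕ} (S : BergenHill n)

/-- The linearised weights of the shifted record (frame rotating at `ω₀`) are the residual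
capacities `bᵢⱼcos(θᵢ − θⱼ)` of the data (`a = b`, `toDroopNetwork_a`; `shifted` keeps `b`).
[cite: Padiyar2013, §3.2 eqs. (3.3)–(3.5); DorflerChertkovBullo2013, SI §2.4] -/
theorem shifted_linWeight (θ : Fin n → ℝ) (i j : Fin n) :
    S.shifted.toDroopNetwork.linWeight θ i j = S.b i j * Real.cos (θ i - θ j) := by
  have ha : S.shifted.toDroopNetwork.a = S.b := S.shifted.toDroopNetwork_a
  simp only [DroopNetwork.linWeight, ha]

/-- The linearised weights of the record itself are the residual capacities `bᵢⱼcos(θᵢ − θⱼ)`.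
[cite: DorflerChertkovBullo2013, SI §2.4 and §3.1 Lemma 2 (1)] -/
theorem toDroopNetwork_linWeight (θ : Fin n → ℝ) (i j : Fin n) :
    S.toDroopNetwork.linWeight θ i j = S.b i j * Real.cos (θ i - θ j) := by
  have ha : S.toDroopNetwork.a = S.b := S.toDroopNetwork_a
  simp only [DroopNetwork.linWeight, ha]

variable {S}

/-- **Lemma 1's stable clause for FORWARD solutions** (`Mᵢ ≥ 0`, `Dᵢ > 0`, `b` symmetric; an
equilibrium `δ⁰` of the record in its own frame, `Σⱼ bᵢⱼ sin(δ⁰ᵢ − δ⁰ⱼ) = P⁰ᵢ`, with the PSD + kernel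
certificate of the Hesse form `u ↦ Σᵢ uᵢ Σⱼ bᵢⱼcos(δ⁰ᵢ − δ⁰ⱼ)(uᵢ − uⱼ)`): there are `ρ, k, λ > 0` such
that every FORWARD solution `(δ, v)` (`IsSolutionAt` at every `t ≥ 0`) with
`‖(δ(0) − δ⁰, v_G(0))‖ < ρ` satisfies
`‖(δ(t) − (δ⁰ + c𝟙), v_G(t))‖ ≤ k‖(δ(0) − (δ⁰ + c𝟙), v_G(0))‖e^{−λt}` for `t ≥ 0`,
`c = (Σᵢ Dᵢ(δᵢ(0) − δ⁰ᵢ) + Σ_{gen} Mᵢvᵢ(0))/Σᵢ Dᵢ`. (The tree's theorem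
`syncEquilibrium_locally_expStable_of_posCurvature` is stated for solutions given at every real time;
a forward solution coincides on `t ≥ 0` with the global motion of its initial state,
`exists_solution` / `solution_unique`.)
[cite: ManikTimmeWitthaut2017, §3 Lemma 1 (stable clause, «power grid model»); DorflerChertkovBullo2013, SI §3.1 Lemma 1 (ii) with Lemma 2 (2); Padiyar2013, §3.2 eqs. (3.2), (3.10a)–(3.10b)] -/
theorem locally_expStable_of_posCurvature_of_forward (hM : ∀ i, 0 ≤ S.M i) (hD : ∀ i, 0 < S.D i)
    (hb : ∀ i j, S.b i j = S.b j i) {δ0 : Fin n → ℝ} (hδ0 : S.IsEquilibrium δ0)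
    (hpsd : ∀ u : Fin n → ℝ, 0 ≤ ∑ i, u i * ∑ j, S.b i j * Real.cos (δ0 i - δ0 j) * (u i - u j))
    (hker : ∀ u : Fin n → ℝ, ∑ i, u i * ∑ j, S.b i j * Real.cos (δ0 i - δ0 j) * (u i - u j) = 0 →
      ∃ a : ℝ, u = fun _ => a) :
    ∃ ρ > 0, ∃ k > 0, ∃ lam > 0, ∀ δ v : ℝ → Fin n → ℝ, (∀ t, 0 ≤ t → S.IsSolutionAt δ v t) →
      ‖S.phase (δ 0 - δ0) (fun g => v 0 g.1)‖ < ρ →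
      ∀ t : ℝ, 0 ≤ t →
        ‖S.phase (fun i => δ t i - (δ0 i
              + (∑ j, S.D j * (δ 0 j - δ0 j) + ∑ g : S.Gen, S.M g.1 * v 0 g.1) / ∑ j, S.D j))
            (fun g => v t g.1)‖
          ≤ k * ‖S.phase (fun i => δ 0 i - (δ0 i
              + (∑ j, S.D j * (δ 0 j - δ0 j) + ∑ g : S.Gen, S.M g.1 * v 0 g.1) / ∑ j, S.D j))
            (fun g => v 0 g.1)‖ * Real.exp (-lam * t) := by
  have hpsd' : ∀ u : Fin n → ℝ,
      0 ≤ ∑ i, u i * ∑ j, S.toDroopNetwork.linWeight δ0 i j * (u i - u j) := fun u => by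
    simpa only [toDroopNetwork_linWeight] using hpsd u
  have hker' : ∀ u : Fin n → ℝ,
      ∑ i, u i * ∑ j, S.toDroopNetwork.linWeight δ0 i j * (u i - u j) = 0 →
      ∃ a : ℝ, u = fun _ => a := fun u hu => by
    refine hker u ?_
    simpa only [toDroopNetwork_linWeight] using hu
  obtain ⟨ρ, hρ, k, hk, lam, hlam, H⟩ :=
    syncEquilibrium_locally_expStable_of_posCurvature hM hD hb hδ0 hpsd' hker'
  refine ⟨ρ, hρ, k, hk, lam, hlam, fun δ v hsol h0 t ht => ?_⟩
  -- the global motion of the initial state `(δ(0), v(0))`, and uniqueness on `t ≥ 0`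
  obtain ⟨δg, vg, hg0, hgv0, hg⟩ := S.exists_solution (fun i _ => (hD i).ne') (δ 0) (v 0)
  have huniq : ∀ s, 0 ≤ s → δ s = δg s ∧ v s = vg s := fun s hs =>
    S.solution_unique (fun i _ => (hD i).ne') hsol (fun r _ => hg r) hg0.symm
      (fun i hi => (hgv0 i hi).symm) hs
  have hv0 : vg 0 = v 0 := ((huniq 0 le_rfl).2).symm
  have hδt : δg t = δ t := ((huniq t ht).1).symm
  have hvt : vg t = v t := ((huniq t ht).2).symm
  have key := H δg vg hg (by rw [hg0, hv0]; exact h0) t ht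
  rw [hg0, hv0, hδt, hvt] at key
  exact key

/-- **THE STABLE CLAUSE IN THE FRAME OF THE DATA** (`Mᵢ ≥ 0`, `Dᵢ > 0`, `b` symmetric). Let `θe`
be a synchronous state, `Σⱼ bₖⱼ sin(θeₖ − θeⱼ) = P̄ₖ = P⁰ₖ − Dₖω₀` with `ω₀ = ΣP⁰ᵢ/ΣDᵢ` the synchronous
frequency, at which the Hesse form `u ↦ Σᵢ uᵢ Σⱼ bᵢⱼcos(θeᵢ − θeⱼ)(uᵢ − uⱼ)` is `≥ 0` with kernel the
constants. Then there are `ρ, k, λ > 0` such that every FORWARD solution `(δ, v)` of (3.2) with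
`‖(δ(0) − θe, v_G(0) − ω₀𝟙)‖ < ρ` satisfies, for all `t ≥ 0`,
`‖(δ(t) − ω₀t𝟙 − (θe + c𝟙), v_G(t) − ω₀𝟙)‖ ≤ k‖(δ(0) − (θe + c𝟙), v_G(0) − ω₀𝟙)‖e^{−λt}`,
`c = (Σᵢ Dᵢ(δᵢ(0) − θeᵢ) + Σ_{gen} Mᵢ(vᵢ(0) − ω₀))/Σᵢ Dᵢ`: the synchronous solution
`(θe + ω₀t𝟙, ω₀𝟙)` is locally exponentially STABLE modulo the uniform rotation, each nearby motion
locking onto the rotated copy `(θe + c𝟙 + ω₀t𝟙, ω₀𝟙)` selected by its own conserved quantity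
`Σᵢ Dᵢδᵢ + Σ_{gen} Mᵢvᵢ` («transversally asymptotically stable»). Proof: the change of frame
`isSolutionAt_shifted_iff` makes `(δ − ω₀t𝟙, v − ω₀𝟙)` a forward solution of the shifted record
(`P̄`, `Σ P̄ᵢ = 0`), of which `θe` is an equilibrium; then `locally_expStable_of_posCurvature_of_forward`.
[cite: ManikTimmeWitthaut2017, §3 Lemma 1 (stable clause); DorflerChertkovBullo2013, SI §3.1 Lemma 1 (ii) with Lemma 2 (2); Padiyar2013, §3.2 eqs. (3.2)–(3.5) (the frame rotating at ω₀)] -/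
theorem syncSolution_locally_expStable_of_posCurvature (hM : ∀ i, 0 ≤ S.M i)
    (hD : ∀ i, 0 < S.D i) (hb : ∀ i j, S.b i j = S.b j i) {θe : Fin n → ℝ}
    (hec : ∀ k, S.flow θe k = S.shiftedInjection k)
    (hpsd : ∀ u : Fin n → ℝ, 0 ≤ ∑ i, u i * ∑ j, S.b i j * Real.cos (θe i - θe j) * (u i - u j))
    (hker : ∀ u : Fin n → ℝ, ∑ i, u i * ∑ j, S.b i j * Real.cos (θe i - θe j) * (u i - u j) = 0 →
      ∃ a : ℝ, u = fun _ => a) :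
    ∃ ρ > 0, ∃ k > 0, ∃ lam > 0, ∀ δ v : ℝ → Fin n → ℝ, (∀ t, 0 ≤ t → S.IsSolutionAt δ v t) →
      ‖S.phase (δ 0 - θe) (fun g => v 0 g.1 - S.syncFrequency)‖ < ρ →
      ∀ t : ℝ, 0 ≤ t →
        ‖S.phase (fun i => δ t i - S.syncFrequency * t - (θe i
              + (∑ j, S.D j * (δ 0 j - θe j)
                  + ∑ g : S.Gen, S.M g.1 * (v 0 g.1 - S.syncFrequency)) / ∑ j, S.D j))
            (fun g => v t g.1 - S.syncFrequency)‖
          ≤ k * ‖S.phase (fun i => δ 0 i - (θe i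
              + (∑ j, S.D j * (δ 0 j - θe j)
                  + ∑ g : S.Gen, S.M g.1 * (v 0 g.1 - S.syncFrequency)) / ∑ j, S.D j))
            (fun g => v 0 g.1 - S.syncFrequency)‖ * Real.exp (-lam * t) := by
  have hMs : ∀ i, 0 ≤ S.shifted.M i := hM
  have hDs : ∀ i, 0 < S.shifted.D i := hD
  have hbs : ∀ i j, S.shifted.b i j = S.shifted.b j i := hb
  have hδ0 : S.shifted.IsEquilibrium θe := fun k => by
    rw [BergenHill.shifted_flow, BergenHill.shifted_P0]
    exact hec k
  have hpsd' : ∀ u : Fin n → ℝ,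
      0 ≤ ∑ i, u i * ∑ j, S.shifted.b i j * Real.cos (θe i - θe j) * (u i - u j) := hpsd
  have hker' : ∀ u : Fin n → ℝ,
      ∑ i, u i * ∑ j, S.shifted.b i j * Real.cos (θe i - θe j) * (u i - u j) = 0 →
      ∃ a : ℝ, u = fun _ => a := hker
  obtain ⟨ρ, hρ, k, hk, lam, hlam, H⟩ :=
    locally_expStable_of_posCurvature_of_forward (S := S.shifted) hMs hDs hbs hδ0 hpsd' hker'
  refine ⟨ρ, hρ, k, hk, lam, hlam, fun δ v hsol h0 t ht => ?_⟩
  -- the motion read in the frame rotating at `ω₀` is a forward solution of the shifted record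
  have hsol' : ∀ s, 0 ≤ s → S.shifted.IsSolutionAt (fun s i => δ s i - S.syncFrequency * s)
      (fun s i => v s i - S.syncFrequency) s := fun s hs => S.isSolutionAt_shifted_iff.2 (hsol s hs)
  have e : (fun i => δ 0 i - S.syncFrequency * 0) = δ 0 := funext fun i => by simp
  have h0' : ‖S.shifted.phase ((fun i => δ 0 i - S.syncFrequency * 0) - θe)
      (fun g => v 0 g.1 - S.syncFrequency)‖ < ρ := by
    rw [e]
    exact h0
  have key := H (fun s i => δ s i - S.syncFrequency * s) (fun s i => v s i - S.syncFrequency) hsol'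
    h0' t ht
  simp only [mul_zero, sub_zero] at key
  exact key

/-- **COROLLARY 1 OF MANIK–TIMME–WITTHAUT FOR THE STRUCTURE-PRESERVING MODEL: «normal operation» on
a connected network ⇒ the synchronous solution is (locally exponentially) STABLE modulo rotation**
(`Mᵢ ≥ 0`, `Dᵢ > 0`, `b` symmetric with `bᵢⱼ ≥ 0` off the diagonal, connected coupling graph
`CouplingConnected b`). If `θe` is a synchronous state (`Σⱼ bₖⱼ sin(θeₖ − θeⱼ) = P̄ₖ`) with
`cos(θeᵢ − θeⱼ) > 0` on every line (`bᵢⱼ > 0`), then there are `ρ, k, λ > 0` such that every forward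
solution `(δ, v)` with `‖(δ(0) − θe, v_G(0) − ω₀𝟙)‖ < ρ` satisfies
`‖(δ(t) − ω₀t𝟙 − (θe + c𝟙), v_G(t) − ω₀𝟙)‖ ≤ k‖(δ(0) − (θe + c𝟙), v_G(0) − ω₀𝟙)‖e^{−λt}` for
`t ≥ 0` (`c` the rotation offset of the initial state's leaf). «Consider a simply connected network.
A fixed point θ* is transversally asymptotically stable if cos(θ*ᵢ − θ*ⱼ) > 0 holds for all edges» —
here for the mixed first/second-order motions of Padiyar's (3.2), with a rate. THREE COLUMNS:
CERTIFIED for MODEL `M` = structure-preserving model (MV-3), CLASS `C` = the `ρ`-ball; «stable» = the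
synchronous solution of MODEL `M`, never a grid.
[cite: ManikTimmeWitthaut2017, §3 Cor. 1 («normal operation») with Lemma 1; DorflerChertkovBullo2013, SI §3.1 Lemma 2 (2) and Lemma 1 (ii); Padiyar2013, §3.2 eqs. (3.2)–(3.5)] -/
theorem syncSolution_locally_expStable_of_normalOperation (hM : ∀ i, 0 ≤ S.M i)
    (hD : ∀ i, 0 < S.D i) (hb : ∀ i j, S.b i j = S.b j i) (hb0 : ∀ i j, i ≠ j → 0 ≤ S.b i j)
    (hconn : ClassicalModel.CouplingConnected S.b) {θe : Fin n → ℝ}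
    (hec : ∀ k, S.flow θe k = S.shiftedInjection k)
    (hcoh : ∀ i j, i ≠ j → 0 < S.b i j → 0 < Real.cos (θe i - θe j)) :
    ∃ ρ > 0, ∃ k > 0, ∃ lam > 0, ∀ δ v : ℝ → Fin n → ℝ, (∀ t, 0 ≤ t → S.IsSolutionAt δ v t) →
      ‖S.phase (δ 0 - θe) (fun g => v 0 g.1 - S.syncFrequency)‖ < ρ →
      ∀ t : ℝ, 0 ≤ t →
        ‖S.phase (fun i => δ t i - S.syncFrequency * t - (θe i
              + (∑ j, S.D j * (δ 0 j - θe j)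
                  + ∑ g : S.Gen, S.M g.1 * (v 0 g.1 - S.syncFrequency)) / ∑ j, S.D j))
            (fun g => v t g.1 - S.syncFrequency)‖
          ≤ k * ‖S.phase (fun i => δ 0 i - (θe i
              + (∑ j, S.D j * (δ 0 j - θe j)
                  + ∑ g : S.Gen, S.M g.1 * (v 0 g.1 - S.syncFrequency)) / ∑ j, S.D j))
            (fun g => v 0 g.1 - S.syncFrequency)‖ * Real.exp (-lam * t) := by
  have hcert := ClassicalModel.posCurvature_of_cohesive_of_connected hb hconn (θ := θe)
    fun i j hij hne => by
      have hpos : 0 < S.b i j := lt_of_le_of_ne (hb0 i j hij) (Ne.symm hne)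
      exact mul_pos hpos (hcoh i j hij hpos)
  exact syncSolution_locally_expStable_of_posCurvature hM hD hb hec hcert.1 hcert.2

/-! ### §3. RADIAL NETWORKS, hypothesis-free: the phase-cohesive synchronous state is a locally
exponentially STABLE synchronous solution of the structure-preserving model -/

/-- **On a radial network the PHASE-COHESIVE synchronous state is a locally exponentially STABLE
synchronous solution of the structure-preserving model** (`Mᵢ ≥ 0`, `Dᵢ > 0`, `b` symmetric and
supported on the lines of a rooted tree with positive line coefficients; NO isolation, census, arc or
connectivity hypothesis beyond the tree data): if `θc` solves `Σⱼ bₖⱼ sin(θcₖ − θcⱼ) = P̄ₖ` with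
`cos(θcᵢ − θc_{parent i}) > 0` on every branch, then there are `ρ, k, λ > 0` such that every forward
solution `(δ, v)` with `‖(δ(0) − θc, v_G(0) − ω₀𝟙)‖ < ρ` satisfies
`‖(δ(t) − ω₀t𝟙 − (θc + c𝟙), v_G(t) − ω₀𝟙)‖ ≤ k‖(δ(0) − (θc + c𝟙), v_G(0) − ω₀𝟙)‖e^{−λt}` for
`t ≥ 0`. This is the «one is stable» of Cor. 2 AT THE LEVEL OF THE MOTIONS of the structure-preserving
model (its companions with a negative-cosine branch are unstable synchronous solutions,
`unstable_syncSolution_of_neg_branch_of_tree`). THREE COLUMNS: CERTIFIED for MODEL `M` =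
structure-preserving model on a radial network (MV-3), CLASS `C` = the `ρ`-ball; «stable» = the
synchronous solution of MODEL `M`, never a grid.
[cite: ManikTimmeWitthaut2017, §5.2 Cor. 2 («one is stable») with §3 Cor. 1 / Lemma 1; DorflerChertkovBullo2013, SI §3.2 Thm 2 (G1) («exponentially stable equilibrium θ* ∈ Δ̄_G(γ)») and §3.1 Lemma 1 (ii); Padiyar2013, §3.2 eqs. (3.2)–(3.5)] -/
theorem syncSolution_locally_expStable_of_cohesive_of_tree (hM : ∀ i, 0 ≤ S.M i)
    (hD : ∀ i, 0 < S.D i) (hb : ∀ i j, S.b i j = S.b j i)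
    {root : Fin n} {parent : Fin n → Fin n} {depth : Fin n → ℕ}
    (hdepth : ∀ i, i ≠ root → depth i = depth (parent i) + 1)
    (htree : ∀ i j, i ≠ j → S.b i j ≠ 0 → (i ≠ root ∧ j = parent i) ∨ (j ≠ root ∧ i = parent j))
    (ha : ∀ i, i ≠ root → 0 < S.b i (parent i)) {θc : Fin n → ℝ}
    (hec : ∀ k, S.flow θc k = S.shiftedInjection k)
    (hcoh : ∀ i, i ≠ root → 0 < Real.cos (θc i - θc (parent i))) :
    ∃ ρ > 0, ∃ k > 0, ∃ lam > 0, ∀ δ v : ℝ → Fin n → ℝ, (∀ t, 0 ≤ t → S.IsSolutionAt δ v t) →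
      ‖S.phase (δ 0 - θc) (fun g => v 0 g.1 - S.syncFrequency)‖ < ρ →
      ∀ t : ℝ, 0 ≤ t →
        ‖S.phase (fun i => δ t i - S.syncFrequency * t - (θc i
              + (∑ j, S.D j * (δ 0 j - θc j)
                  + ∑ g : S.Gen, S.M g.1 * (v 0 g.1 - S.syncFrequency)) / ∑ j, S.D j))
            (fun g => v t g.1 - S.syncFrequency)‖
          ≤ k * ‖S.phase (fun i => δ 0 i - (θc i
              + (∑ j, S.D j * (δ 0 j - θc j)
                  + ∑ g : S.Gen, S.M g.1 * (v 0 g.1 - S.syncFrequency)) / ∑ j, S.D j))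
            (fun g => v 0 g.1 - S.syncFrequency)‖ * Real.exp (-lam * t) := by
  have hcert := ClassicalModel.posCurvature_of_cohesive_of_rootedTree hdepth hb htree ha hcoh
  exact syncSolution_locally_expStable_of_posCurvature hM hD hb hec hcert.1 hcert.2

/-! ### §4. COROLLARY 2, BOTH CLAUSES, LITERALLY, for the structure-preserving motions on a radial
network: «of the `2ᴺ⁻¹` fixed points … ONE IS STABLE and `2ᴺ⁻¹ − 1` are unstable» -/

/-- **«Of the `2ᴺ⁻¹` fixed points … ONE IS STABLE and `2ᴺ⁻¹ − 1` are unstable» — LITERALLY, for the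
forward motions of the structure-preserving (Bergen–Hill) model on a radial network** (`Mᵢ ≥ 0`,
`Dᵢ > 0`, `b` symmetric, tree-supported with positive line coefficients, strictly feasible tree flows
`|uᵢ| < b_{i, parent i}` of the synchronous-frame injections `P̄`). With `θc` the pinned phase-cohesive
synchronous state of the period box `[−π, π)ⁿ` (`cos > 0` on every branch): (i) the pinned
synchronous states of the box other than `θc` number exactly `2ⁿ⁻¹ − 1` and EVERY one of them is an
UNSTABLE synchronous solution — `∃ ε > 0 ∀ r > 0 ∃ θ₁` on its momentum level with `dist(θ₁, θe) < r`
such that every forward solution from bus angles `θ₁` with the rotors at `ω₀` gets farther than `ε`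
from `(θe + ω₀t𝟙, ω₀𝟙)` (`ncard_unstable_syncStates_of_tree`, energy route); (ii) `θc` is a locally
exponentially STABLE synchronous solution in the sense of
`syncSolution_locally_expStable_of_cohesive_of_tree` (spectral route). THREE COLUMNS: CERTIFIED for
MODEL `M` = structure-preserving model on a radial network (MV-3), every `D > 0`; «stable» /
«unstable» = synchronous solutions of MODEL `M`, never a grid; type labels beyond stable/unstable are
not asserted.
[cite: ManikTimmeWitthaut2017, §5.2 Cor. 2 («there are 2^{N−1} fixed points of which one is stable and 2^{N−1} − 1 are unstable») and its proof; DorflerChertkovBullo2013, SI §3.2 Thm 2 (G1) and §3.1 Lemma 1 (ii); Padiyar2013, §3.2 eqs. (3.2)–(3.5); Chiang1995, §3 Thm 3.1] -/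
theorem one_stable_and_ncard_unstable_syncStates_of_tree (hb : ∀ i j, S.b i j = S.b j i)
    (hM : ∀ i, 0 ≤ S.M i) (hD : ∀ i, 0 < S.D i)
    {root : Fin n} {parent : Fin n → Fin n} {depth : Fin n → ℕ} (hpr : parent root = root)
    (hroot : depth root = 0) (hdepth : ∀ i, i ≠ root → depth i = depth (parent i) + 1)
    (htree : ∀ i j, i ≠ j → S.b i j ≠ 0 → (i ≠ root ∧ j = parent i) ∨ (j ≠ root ∧ i = parent j))
    (ha : ∀ i, i ≠ root → 0 < S.b i (parent i)) (u : Fin n → ℝ)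
    (hcons : ∀ i, S.shiftedInjection i = (if i ≠ root then u i else 0)
      - ∑ j ∈ Finset.univ.filter (fun j => j ≠ root ∧ parent j = i), u j)
    (hu : ∀ i, i ≠ root → |u i| < S.b i (parent i))
    {θc : Fin n → ℝ} (hrc : θc root = 0) (hboxc : ∀ i, θc i ∈ Set.Ico (-π) π)
    (hec : ∀ k, S.flow θc k = S.shiftedInjection k)
    (hcoh : ∀ i, i ≠ root → 0 < Real.cos (θc i - θc (parent i))) :
    ({θ : Fin n → ℝ | θ root = 0 ∧ (∀ i, θ i ∈ Set.Ico (-π) π) ∧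
        ∀ k, S.flow θ k = S.shiftedInjection k} \ {θc}).ncard = 2 ^ (n - 1) - 1 ∧
      (∀ θe ∈ {θ : Fin n → ℝ | θ root = 0 ∧ (∀ i, θ i ∈ Set.Ico (-π) π) ∧
          ∀ k, S.flow θ k = S.shiftedInjection k} \ {θc},
        ∃ ε > 0, ∀ r > 0, ∃ θ₁ : Fin n → ℝ, dist θ₁ θe < r ∧
          ∑ k, S.D k * θ₁ k = ∑ k, S.D k * θe k ∧
          ∀ δ v : ℝ → Fin n → ℝ, δ 0 = θ₁ → (∀ k, S.M k ≠ 0 → v 0 k = S.syncFrequency) →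
            (∀ t, 0 ≤ t → S.IsSolutionAt δ v t) →
            ∃ t, 0 ≤ t ∧ ε < dist ((δ t, v t) : (Fin n → ℝ) × (Fin n → ℝ))
              ((fun k => θe k + S.syncFrequency * t), fun _ => S.syncFrequency)) ∧
      ∃ ρ > 0, ∃ k > 0, ∃ lam > 0, ∀ δ v : ℝ → Fin n → ℝ, (∀ t, 0 ≤ t → S.IsSolutionAt δ v t) →
        ‖S.phase (δ 0 - θc) (fun g => v 0 g.1 - S.syncFrequency)‖ < ρ →
        ∀ t : ℝ, 0 ≤ t →
          ‖S.phase (fun i => δ t i - S.syncFrequency * t - (θc i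
                + (∑ j, S.D j * (δ 0 j - θc j)
                    + ∑ g : S.Gen, S.M g.1 * (v 0 g.1 - S.syncFrequency)) / ∑ j, S.D j))
              (fun g => v t g.1 - S.syncFrequency)‖
            ≤ k * ‖S.phase (fun i => δ 0 i - (θc i
                + (∑ j, S.D j * (δ 0 j - θc j)
                    + ∑ g : S.Gen, S.M g.1 * (v 0 g.1 - S.syncFrequency)) / ∑ j, S.D j))
              (fun g => v 0 g.1 - S.syncFrequency)‖ * Real.exp (-lam * t) := by
  obtain ⟨h1, h2⟩ := S.ncard_unstable_syncStates_of_tree hb hM hD hpr hroot hdepth htree ha u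
    hcons hu hrc hboxc hec (fun i hi => (hcoh i hi).le)
  exact ⟨h1, h2,
    syncSolution_locally_expStable_of_cohesive_of_tree hM hD hb hdepth htree ha hec hcoh⟩

end BergenHill

end Literature.MathematicalPhysics.PowerSystems

end
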